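import Summits.ABC.IUTFork.Cor312SettingDHVol
import Summits.ABC.IUTFork.Cor312VolumesPadicPerm
import Literature.IUT.LogVolume.LogShellTopology
import Literature.IUT.LogVolume.PacketBases
import HarnessLib

/-!
# [IUTchIII] Cor. 3.12 — the field-factor comparison of a `p`-adic presentation: onto, multiplicative on pure tensors,
# BOUNDED on the lattice `I(^{S^±_{j+1}};𝒟^⊢_{v_ℚ})`; saturation and the intertwiners of (Ind1)/(Ind2)

Record-only file (D-0012) of the abc-iut cell (Cor. 3.12 sub-crew, seat abc-iut-c312-6 gen 4; TEAM B support row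
«(G1)-vehicle side conditions at the assembled real setting»; the generic half of `Cor312SettingDHVolFinite`); PROOF-ONLY;
TAKES NO SIDE. Over ANY `PadicPresentation` (abc-iut-c312-5 `Cor312VolumesPadicSummands`) of a log-shell signature at a
prime — the data through which abc-iut-c312-5's `Real.settingDHVol` (p417107) reads the real packets — this file proves
the packet-level facts that discharge two of the three owned inputs of abc-iut-c312-7's `hullDefined_of_stable`
(«compactness of `^{1,∘}𝒰_{j,v_ℚ}`», [IUTchIII] kurims `paper:url-4b091feeb646` p. 175 l. 2–4) at the real setting:

* §1 the field-factor comparison `x ↦ (ψ_{v⃗}(e(x)_{v⃗})_i)` (`PadicPresentation.factorMap`) is additive and ONTO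
  (`factorMap_surjective`); on a pure tensor its `(v⃗,i)`-component is the PRODUCT of the images of the components under the
  ISOMETRIC field-factor embeddings `K_{v⃗ a} → L_{v⃗,i}` (`factorMap_tprod`, `norm_factorMap_tprod`; abc-iut-c312-3
  `norm_dEquiv_iota`, [IUTchIV] Prop. 1.4 (i)); the log-shells `φ_v(I_v) = c·log_p(𝒪^×)` are compact (campaign-S
  `isCompact_logUnits`) and a closed ball of an ultrametric field is an additive subgroup, so **the image of the lattice
  `I(^{S^±_{j+1}};𝒟^⊢_{v_ℚ})` (abc-iut-c312-5 `LogShells.shellPk`) — and of each rational multiple — is BOUNDED**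
  (`isBounded_factorMap_image_smul_shellPk`);
* §2 SATURATION `e⁻¹(e(S))` under the summand comparison: a packet automorphism intertwined by `e` with a self-map of
  `Π_{v⃗} X_{v⃗}` and mapping `S` into `S` maps `e⁻¹(e(S))` into itself (`image_preimage_image_subset_of_semiconj`); every element of
  abc-iut-c312-1's `Ind1 j` / `Ind2 j v_ℚ` IS so intertwined (abc-iut-c312-5 `perm_preserves`/`strip_preserves`/`ism_preserves`
  — `exists_semiconj_of_mem_Ind1/2`); the field-factor image of the saturation is that of `S`.
[claim: Mochizuki2012, status: disputed] for the quoted setting; [cite: DupuyHilado2025, §4.7, §4.9]. No judgement.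
-/

noncomputable section

open Set Function Metric
open scoped Pointwise

namespace Summit.ABC

namespace IUTFork

namespace Cor312Vol

namespace PadicPresentation

open Thm311 Literature.IUT.LogThetaLattice Literature.IUT.LogVolume

variable {T : ThetaIndex} {L : LogShells T} {vQ : T.VQ} {p : ℕ} [Fact p.Prime] (P : PadicPresentation L vQ p)

/-! ## 1. The field-factor comparison: onto, multiplicative on pure tensors, bounded on the lattice -/

/-- The field-factor comparison is additive in the packet variable. [folklore] -/
theorem factorMap_add (j : T.Label) (x y : L.Packet j vQ) (s : P.factorIdx j) :
    P.factorMap j (x + y) s = P.factorMap j x s + P.factorMap j y s := by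
  simp only [factorMap, map_add, Pi.add_apply]

/-- … and vanishes at `0`. [folklore] -/
theorem factorMap_zero (j : T.Label) (s : P.factorIdx j) : P.factorMap j 0 s = 0 := by
  simp only [factorMap, map_zero, Pi.zero_apply]

/-- … and is odd. [folklore] -/
theorem factorMap_neg (j : T.Label) (x : L.Packet j vQ) (s : P.factorIdx j) :
    P.factorMap j (-x) s = -P.factorMap j x s := by
  simp only [factorMap, map_neg, Pi.neg_apply]

/-- **The field-factor comparison is ONTO** `Π_{(v⃗,i)} L_{v⃗,i}` (the summand comparison is onto, abc-iut-c312-5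
`comparison_surjective`; each `ψ_{v⃗}` is bijective). [folklore] -/
theorem factorMap_surjective (j : T.Label) :
    Function.Surjective (fun x : L.Packet j vQ => fun s : P.factorIdx j => P.factorMap j x s) := by
  intro t
  obtain ⟨x, hx⟩ := P.comparison_surjective j fun e => (dEquiv p (P.kk e)).symm fun i => t ⟨e, i⟩
  refine ⟨x, funext fun s => ?_⟩
  obtain ⟨e, i⟩ := s
  show dEquiv p (P.kk e) (P.comparison j x e) i = t ⟨e, i⟩
  rw [hx, AlgEquiv.apply_symm_apply]

/-- **The `(v⃗,i)`-component of a pure tensor** `x_0 ⊗ ⋯ ⊗ x_j` under the field-factor comparison is the PRODUCT of the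
images of the components `φ_{v⃗ a}(x_{a,v⃗ a})` under the field-factor embeddings `K_{v⃗ a} → L_{v⃗,i}` ([IUTchIII] Prop.
3.1 (i): `e(⊗ x)_{v⃗} = ⊗_a φ(x_{a,v⃗ a})`; [IUTchIV] Prop. 1.4 (i)). [folklore] -/
theorem factorMap_tprod (j : T.Label) (y : T.Caps j → L.Packet1 vQ) (s : P.factorIdx j) :
    P.factorMap j (L.tprod j vQ y) s =
      ∏ a, dEquiv p (P.kk s.1) (iota p (P.kk s.1) a (P.φ (s.1 a) (y a (s.1 a)))) s.2 := by
  classical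
  show dEquiv p (P.kk s.1) (P.comparison j (PiTensorProduct.tprod ℚ y) s.1) s.2 = _
  rw [comparison_tprod]
  change dEquiv p (P.kk s.1) (purePacket p (P.kk s.1) fun a => P.φ (s.1 a) (y a (s.1 a))) s.2 = _
  rw [purePacket_eq_prod_iota, map_prod, Finset.prod_apply]

/-- … so its norm is the product of the norms `‖φ_{v⃗ a}(x_{a,v⃗ a})‖` — the field-factor embeddings are ISOMETRIC
(abc-iut-c312-3 `norm_dEquiv_iota`). [cite: Mochizuki2012, IUTchIV Prop. 1.4 (i) p. 13] -/
theorem norm_factorMap_tprod (j : T.Label) (y : T.Caps j → L.Packet1 vQ) (s : P.factorIdx j) :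
    ‖P.factorMap j (L.tprod j vQ y) s‖ = ∏ a, ‖P.φ (s.1 a) (y a (s.1 a))‖ := by
  classical
  rw [factorMap_tprod, norm_prod]
  exact Finset.prod_congr rfl fun a _ => norm_dEquiv_iota p (P.kk s.1) a _ s.2

/-- **The 1-packet log-shell lattice `⟨I_v⟩` is bounded in `K_v`**: `φ_v(I_v) = c·log_p(𝒪^×)` is compact (campaign-S
`isCompact_logUnits`), and a closed ball of the ultrametric `K_v` is an additive subgroup, so it contains the generated
lattice. [folklore] -/
theorem exists_norm_φ_le_of_mem_shellSubgroup (v : T.Fibre vQ) :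
    ∃ r : ℝ, 0 < r ∧ ∀ y ∈ (L.shellSubgroup v.1 : Set (L.carrier v.1)), ‖P.φ v y‖ ≤ r := by
  have hcpt : IsCompact (P.c • logUnits (P.k v)) := by
    rw [← Set.image_smul]
    exact (isCompact_logUnits p (P.k v)).image (continuous_const_smul P.c)
  obtain ⟨r, hr⟩ := hcpt.isBounded.subset_closedBall 0
  refine ⟨max r 1, by positivity, fun y hy => ?_⟩
  let B : AddSubgroup (P.k v) :=
    (IsUltrametricDist.closedBall_openAddSubgroup (P.k v) (r := max r 1) (by positivity)).toAddSubgroup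
  have key : L.shellSubgroup v.1 ≤ B.comap (P.φ v).toLinearMap.toAddMonoidHom := by
    show AddSubgroup.closure (L.shell v.1) ≤ _
    refine (AddSubgroup.closure_le _).mpr fun z hz => ?_
    have hz' : P.φ v z ∈ P.c • logUnits (P.k v) := by rw [← P.shell_eq v]; exact ⟨z, hz, rfl⟩
    show P.φ v z ∈ closedBall (0 : P.k v) (max r 1)
    exact closedBall_subset_closedBall (le_max_left _ _) (hr hz')
  have hmem : P.φ v y ∈ closedBall (0 : P.k v) (max r 1) := key hy
  rwa [mem_closedBall, dist_zero_right] at hmem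

/-- **The image of `I(^{S^±_{j+1}};𝒟^⊢_{v_ℚ})` under the field-factor comparison is bounded**, coordinatewise by the product of
the 1-packet radii: on the generating pure tensors by `norm_factorMap_tprod`, and the sub-level set of an additive map
into an ultrametric field is an additive subgroup. [folklore] -/
theorem exists_norm_factorMap_le_of_mem_shellPk (j : T.Label) :
    ∃ R : P.factorIdx j → ℝ, (∀ s, 0 ≤ R s) ∧
      ∀ x ∈ (L.shellPk j vQ : Set (L.Packet j vQ)), ∀ s, ‖P.factorMap j x s‖ ≤ R s := by
  classical
  choose r hr0 hr using P.exists_norm_φ_le_of_mem_shellSubgroup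
  refine ⟨fun s => ∏ a, r (s.1 a), fun s => Finset.prod_nonneg fun a _ => (hr0 _).le, fun x hx => ?_⟩
  rw [LogShells.shellPk_eq_closure] at hx
  refine AddSubgroup.closure_induction (fun t ht s => ?_) (fun s => ?_) (fun x y _ _ hx hy s => ?_)
    (fun x _ hx s => ?_) hx
  · obtain ⟨y, hy, rfl⟩ := ht
    show ‖P.factorMap j (L.tprod j vQ y) s‖ ≤ ∏ a, r (s.1 a)
    rw [norm_factorMap_tprod]
    exact Finset.prod_le_prod (fun a _ => norm_nonneg _) fun a _ => hr (s.1 a) _ (hy a (s.1 a))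
  · show ‖P.factorMap j 0 s‖ ≤ ∏ a, r (s.1 a)
    rw [factorMap_zero, norm_zero]
    exact Finset.prod_nonneg fun a _ => (hr0 _).le
  · rw [factorMap_add]
    exact (IsUltrametricDist.norm_add_le_max _ _).trans (max_le (hx s) (hy s))
  · rw [factorMap_neg, norm_neg]
    exact hx s

/-- **… and so is the image of every rational multiple `c • I(^{S^±_{j+1}};𝒟^⊢_{v_ℚ})`** (additive maps commute with rational
scalars, `map_ratCast_smul`). [folklore] -/
theorem isBounded_factorMap_image_smul_shellPk (j : T.Label) (c : ℚ) :
    Bornology.IsBounded ((fun x : L.Packet j vQ => fun s : P.factorIdx j => P.factorMap j x s) ''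
      (c • (L.shellPk j vQ : Set (L.Packet j vQ)))) := by
  obtain ⟨R, -, hR⟩ := P.exists_norm_factorMap_le_of_mem_shellPk j
  refine (Bornology.IsBounded.pi fun s : P.factorIdx j =>
    (isBounded_closedBall (x := (0 : P.factorField j s)) (r := ‖((c : ℚ) : P.factorField j s)‖ * R s))).subset ?_
  rintro _ ⟨_, ⟨x, hx, rfl⟩, rfl⟩ s -
  rw [mem_closedBall, dist_zero_right]
  let f : L.Packet j vQ →+ P.factorField j s :=
    { toFun := fun x => P.factorMap j x s
      map_zero' := P.factorMap_zero j s
      map_add' := fun x y => P.factorMap_add j x y s }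
  have hf : P.factorMap j ((c : ℚ) • x) s = ((c : ℚ) : P.factorField j s) • P.factorMap j x s :=
    map_ratCast_smul f ℚ (P.factorField j s) c x
  show ‖P.factorMap j (c • x) s‖ ≤ _
  rw [hf, smul_eq_mul, norm_mul]
  exact mul_le_mul_of_nonneg_left (hR x hx s) (norm_nonneg _)

/-- A linear automorphism mapping `W` onto itself maps every rational multiple `c • W` onto itself (abc-iut-c312-7's
`Setting.image_smul_set_eq_of_image_eq`, restated over a bare `ℚ`-module so that no `Situation` has to be named).
[folklore] -/
theorem _root_.Summit.ABC.IUTFork.Cor312Vol.image_smul_set_eq_of_image_eq' {V : Type} [AddCommGroup V] [Module ℚ V]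
    (Φ : V ≃ₗ[ℚ] V) {W : Set V} (hW : Φ '' W = W) (c : ℚ) : Φ '' (c • W) = c • W := by
  ext y
  constructor
  · rintro ⟨x, hx, rfl⟩
    obtain ⟨w, hw, rfl⟩ := Set.mem_smul_set.mp hx
    refine Set.mem_smul_set.mpr ⟨Φ w, ?_, by rw [map_smul]⟩
    rw [← hW]
    exact ⟨w, hw, rfl⟩
  · intro hy
    obtain ⟨w', hw', rfl⟩ := Set.mem_smul_set.mp hy
    rw [← hW] at hw'
    obtain ⟨w, hw, rfl⟩ := hw'
    exact ⟨c • w, Set.smul_mem_smul_set hw, by rw [map_smul]⟩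

/-! ### Saturation of a subset of the packet under the summand comparison; intertwiners of (Ind1)/(Ind2) -/

/-- A packet automorphism `φ` INTERTWINED by the summand comparison with some self-map `Ψ` of `Π_{v⃗} X_{v⃗}` and
mapping `S` into `S` maps the comparison-SATURATION `e⁻¹(e(S))` of `S` into itself. [folklore] -/
theorem image_preimage_image_subset_of_semiconj {j : T.Label} {φ : L.Packet j vQ ≃ₗ[ℚ] L.Packet j vQ}
    {Ψ : (∀ e : T.Caps j → T.Fibre vQ, P.X e) → ∀ e : T.Caps j → T.Fibre vQ, P.X e}
    (h : ∀ x, P.comparison j (φ x) = Ψ (P.comparison j x)) {S : Set (L.Packet j vQ)} (hS : φ '' S ⊆ S) :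
    φ '' (P.comparison j ⁻¹' (P.comparison j '' S)) ⊆ P.comparison j ⁻¹' (P.comparison j '' S) := by
  rintro _ ⟨x, ⟨s, hs, hsx⟩, rfl⟩
  refine ⟨φ s, hS ⟨s, hs, rfl⟩, ?_⟩
  rw [h, h, hsx]

/-- The field-factor image of the saturation of `S` is the field-factor image of `S`. [folklore] -/
theorem factorMap_image_preimage_image {j : T.Label} (S : Set (L.Packet j vQ)) :
    (fun x : L.Packet j vQ => fun s : P.factorIdx j => P.factorMap j x s) ''
        (P.comparison j ⁻¹' (P.comparison j '' S)) =
      (fun x : L.Packet j vQ => fun s : P.factorIdx j => P.factorMap j x s) '' S := by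
  refine Set.Subset.antisymm ?_ (Set.image_mono fun s hs => ⟨s, hs, rfl⟩)
  rintro _ ⟨x, ⟨s, hs, hsx⟩, rfl⟩
  refine ⟨s, hs, funext fun t => ?_⟩
  show dEquiv p (P.kk t.1) (P.comparison j s t.1) t.2 = dEquiv p (P.kk t.1) (P.comparison j x t.1) t.2
  rw [hsx]

/-- A subset whose field-factor image lies in the field-factor image of `S` lies in the saturation of `S` (the
field-factor coordinates `ψ_{v⃗}` are injective). [folklore] -/
theorem subset_preimage_image_of_factorMap_image_subset {j : T.Label} {U S : Set (L.Packet j vQ)}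
    (h : (fun x : L.Packet j vQ => fun s : P.factorIdx j => P.factorMap j x s) '' U ⊆
      (fun x : L.Packet j vQ => fun s : P.factorIdx j => P.factorMap j x s) '' S) :
    U ⊆ P.comparison j ⁻¹' (P.comparison j '' S) := by
  intro x hx
  obtain ⟨s, hs, hsx⟩ := h ⟨x, hx, rfl⟩
  refine ⟨s, hs, funext fun e => (dEquiv p (P.kk e)).injective (funext fun i => ?_)⟩
  exact congrFun hsx ⟨e, i⟩

/-- **(Ind2) is intertwined by the summand comparison** with a self-map of `Π_{v⃗} X_{v⃗}` (abc-iut-c312-5 `ism_preserves`).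
[cite: DupuyHilado2025, §4.9] -/
theorem exists_semiconj_of_mem_Ind2 {j : T.Label} {φ : L.Packet j vQ ≃ₗ[ℚ] L.Packet j vQ} (hφ : φ ∈ L.Ind2 j vQ) :
    ∃ Ψ : (∀ e : T.Caps j → T.Fibre vQ, P.X e) → ∀ e : T.Caps j → T.Fibre vQ, P.X e,
      ∀ x, P.comparison j (φ x) = Ψ (P.comparison j x) := by
  obtain ⟨g, hg, rfl⟩ := hφ
  obtain ⟨Ψ, -, hΨ⟩ := P.ism_preserves g hg
  exact ⟨Ψ, hΨ⟩

/-- **(Ind1) is intertwined by the summand comparison** with a self-map of `Π_{v⃗} X_{v⃗}` (abc-iut-c312-5 `perm_preserves` ∘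
`strip_preserves`). [cite: DupuyHilado2025, §4.7] -/
theorem exists_semiconj_of_mem_Ind1 {j : T.Label} {Φ : ∀ vQ : T.VQ, L.Packet j vQ ≃ₗ[ℚ] L.Packet j vQ}
    (hΦ : Φ ∈ L.Ind1 j) :
    ∃ Ψ : (∀ e : T.Caps j → T.Fibre vQ, P.X e) → ∀ e : T.Caps j → T.Fibre vQ, P.X e,
      ∀ x, P.comparison j (Φ vQ x) = Ψ (P.comparison j x) := by
  obtain ⟨σ, h, hh, hΦ⟩ := hΦ
  obtain ⟨Ψ₁, -, hΨ₁⟩ := P.perm_preserves (j := j) σ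
  obtain ⟨Ψ₂, -, hΨ₂⟩ := P.strip_preserves (j := j) (fun i (v : T.Fibre vQ) => h i v.1) fun i v => hh i v.1
  refine ⟨Ψ₂ ∘ Ψ₁, fun x => ?_⟩
  rw [hΦ vQ, LinearEquiv.trans_apply, hΨ₂, hΨ₁]
  rfl

end PadicPresentation

end Cor312Vol

end IUTFork

end Summit.ABC

end
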